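import Summits.CriticalPhenomena.PercolationContinuityZ3.Theorems.SahiMasterFamilyZeroFlagMinorF
import Summits.CriticalPhenomena.PercolationContinuityZ3.Theorems.PercNearOneGluingNoHeavyLowerTailSahiCombMasterFamily
import Summits.CriticalPhenomena.PercolationContinuityZ3.Theorems.PercNearOneGluingNoHeavyLowerTailSahiCombDisjunctThreeIdentities

/-!
# `F(A,B;G) ≥ 0` for every pair of increasing events when the third event is the union of two coordinates `G = {e₁ ∈ ω} ∪ {e₂ ∈ ω}`

Unit `prim-master-conj` (crux anchor stmt-CriticalPhenomena-4575, helper work), gen 21; memo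
`run/shared/lean/prim/prim-l12/prim-master-conj/POINTWISE.md` §22.4.  Companion of gen 20's `…ZeroFlagMinorF` and gen 21's `…FInequalityFreeCoordinates`.

`F(A,B;G) := (1 + μG)·μ(A∩B∩G) − μG·μ(A∩B) − μ(A∩G)·μ(B∩G)` (gen 20, memo §21) is conjectured `≥ 0` for all increasing `A, B, G`; it is tight at the
classical example `A = x₁, B = x₂, G = x₁ ∨ x₂`.  Here we prove the first NON-PRINCIPAL class with `A, B` unrestricted:

* `fIneq_nonneg_of_two_coordinates` — for `e₁ ≠ e₂`, any product measure and ANY increasing `A, B`:  `F(A, B; {ω | e₁ ∈ ω} ∪ {ω | e₂ ∈ ω}) ≥ 0`.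
  PROOF (memo §22.4, the "transport" template): condition on `(e₁,e₂)`; with the four double sections `X^{ab}` and cell weights `w₁₁ = p₁p₂, w₁₀ = p₁q₂, w₀₁ = q₁p₂,
  w₀₀ = q₁q₂`, `F = Σ'_s w_s t^s − g·w₀₀·t⁰⁰ − (Σ'_s w_s a^s)(Σ'_s w_s b^s)` (`Σ'` over the three cells inside `G`, `t^s = μ(A^s∩B^s)`, `a^s = μ(A^s)`); subtract the
  "transport" `w₀₀(p₁ t¹⁰ + q₁p₂ t⁰¹) ≥ g w₀₀ t⁰⁰` (nested sections), use Harris `t^s ≥ a^s b^s` on the three cells with the nonnegative coefficients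
  `p₁p₂, p₁²q₂, q₁p₂g`, and finish with an explicit 11-term nonnegative expansion of the remaining bilinear form on the cone `0 ≤ a¹⁰, a⁰¹ ≤ a¹¹` (two case splits).
* `sahiE_three_ge_sq_minor_of_third_two_coordinates` — D0-core consequence (via gen 20's `sahiE_three_ge_sq_minor_of_F_nonneg`): `MD_3` at `(U,e)` is unconditional when the
  `e`-free third member is `{e₁ ∈ ω} ∪ {e₂ ∈ ω}`.
Context (memo §22.0): together with the free-coordinate recursion this is the `|supp G| ≤ 2` case of the junta reduction; `|supp G| ≤ 6` holds on paper by exhaustive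
Bernstein censuses, the general case is OPEN. [this work]
-/

noncomputable section

open scoped Classical

namespace Summit.CriticalPhenomena.PercolationContinuityZ3.Theorems

open Finset Function
open Literature.Combinatorics.Sahi2008
open Literature.Probability.Percolation.DecisionTree (ind)

namespace Pointwise

variable {ι : Type} [Fintype ι]

omit [Fintype ι] in
/-- A coordinate event is free in every other coordinate. [folklore] -/
theorem secAt_coord_of_ne {e₁ e₂ : ι} (h : e₁ ≠ e₂) (b : Bool) :
    secAt e₁ b {ω : Set ι | e₂ ∈ ω} = {ω : Set ι | e₂ ∈ ω} := by
  ext ω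
  cases b <;> simp [mem_secAt, forceAt, Ne.symm h]

/-- The copositivity certificate behind `fIneq_nonneg_of_two_coordinates` (memo §22.4): for `p₁, p₂ ∈ [0,1]`, reals `0 ≤ a₁₀, a₀₁ ≤ a₁₁`, `0 ≤ b₁₀, b₀₁ ≤ b₁₁`,
the bilinear form `Σ_s κ_s a^s b^s − (Σ_s w_s a^s)(Σ_s w_s b^s)` with `κ₁₁ = p₁p₂, κ₁₀ = p₁²q₂, κ₀₁ = q₁p₂(p₁+q₁p₂)`, `w₁₁ = p₁p₂, w₁₀ = p₁q₂, w₀₁ = q₁p₂` is `≥ 0`. [this work] -/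
theorem twoCoord_copositive (p₁ p₂ a₁₁ a₁₀ a₀₁ b₁₁ b₁₀ b₀₁ : ℝ) (hp₁ : 0 ≤ p₁) (hp₁' : p₁ ≤ 1) (hp₂ : 0 ≤ p₂) (hp₂' : p₂ ≤ 1)
    (ha₁₀ : 0 ≤ a₁₀) (ha₀₁ : 0 ≤ a₀₁) (ha₁ : a₁₀ ≤ a₁₁) (ha₂ : a₀₁ ≤ a₁₁)
    (hb₁₀ : 0 ≤ b₁₀) (hb₀₁ : 0 ≤ b₀₁) (hb₁ : b₁₀ ≤ b₁₁) (hb₂ : b₀₁ ≤ b₁₁) :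
    0 ≤ p₁ * p₂ * (a₁₁ * b₁₁) + p₁ ^ 2 * (1 - p₂) * (a₁₀ * b₁₀) + (1 - p₁) * p₂ * (p₁ + (1 - p₁) * p₂) * (a₀₁ * b₀₁)
        - (p₁ * p₂ * a₁₁ + p₁ * (1 - p₂) * a₁₀ + (1 - p₁) * p₂ * a₀₁) * (p₁ * p₂ * b₁₁ + p₁ * (1 - p₂) * b₁₀ + (1 - p₁) * p₂ * b₀₁) := by
  have hq₁ : 0 ≤ 1 - p₁ := by linarith
  have hq₂ : 0 ≤ 1 - p₂ := by linarith
  -- entries `rᵢ M rⱼ` of the form on the extreme rays r₁=(0,0,1), r₂=(1,0,1), r₃=(0,1,1), r₄=(1,1,1) (coordinates (a₁₀,a₀₁,a₁₁)):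
  have c11 : 0 ≤ p₁ * p₂ * (1 - p₁ * p₂) := mul_nonneg (mul_nonneg hp₁ hp₂) (by nlinarith [mul_nonneg hp₁ hp₂])
  have c12 : 0 ≤ p₁ * p₂ * (1 - p₁) := mul_nonneg (mul_nonneg hp₁ hp₂) hq₁
  have c13 : 0 ≤ p₁ * p₂ * (1 - p₂) := mul_nonneg (mul_nonneg hp₁ hp₂) hq₂
  have c14 : 0 ≤ p₁ * p₂ * ((1 - p₁) * (1 - p₂)) := mul_nonneg (mul_nonneg hp₁ hp₂) (mul_nonneg hq₁ hq₂)
  have c33 : 0 ≤ p₁ * p₂ * ((1 + (1 - p₁)) * (1 - p₂)) := mul_nonneg (mul_nonneg hp₁ hp₂) (mul_nonneg (by linarith) hq₂)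
  -- cone coordinates: α₄ = min(a₁₀,a₀₁), α₂ = a₁₀ - α₄, α₃ = a₀₁ - α₄, α₁ = a₁₁ - max
  rcases le_total a₁₀ a₀₁ with ha | ha <;> rcases le_total b₁₀ b₀₁ with hb | hb
  · -- α = (a₁₁ - a₀₁, 0, a₀₁ - a₁₀, a₁₀), β = (b₁₁ - b₀₁, 0, b₀₁ - b₁₀, b₁₀)
    have e : p₁ * p₂ * (a₁₁ * b₁₁) + p₁ ^ 2 * (1 - p₂) * (a₁₀ * b₁₀) + (1 - p₁) * p₂ * (p₁ + (1 - p₁) * p₂) * (a₀₁ * b₀₁)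
        - (p₁ * p₂ * a₁₁ + p₁ * (1 - p₂) * a₁₀ + (1 - p₁) * p₂ * a₀₁) * (p₁ * p₂ * b₁₁ + p₁ * (1 - p₂) * b₁₀ + (1 - p₁) * p₂ * b₀₁)
        = p₁ * p₂ * (1 - p₁ * p₂) * ((a₁₁ - a₀₁) * (b₁₁ - b₀₁))
          + p₁ * p₂ * (1 - p₂) * ((a₁₁ - a₀₁) * (b₀₁ - b₁₀)) + p₁ * p₂ * (1 - p₂) * ((a₀₁ - a₁₀) * (b₁₁ - b₀₁))
          + p₁ * p₂ * ((1 - p₁) * (1 - p₂)) * ((a₁₁ - a₀₁) * b₁₀) + p₁ * p₂ * ((1 - p₁) * (1 - p₂)) * (a₁₀ * (b₁₁ - b₀₁))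
          + p₁ * p₂ * ((1 + (1 - p₁)) * (1 - p₂)) * ((a₀₁ - a₁₀) * (b₀₁ - b₁₀))
          + p₁ * p₂ * ((1 - p₁) * (1 - p₂)) * ((a₀₁ - a₁₀) * b₁₀) + p₁ * p₂ * ((1 - p₁) * (1 - p₂)) * (a₁₀ * (b₀₁ - b₁₀)) := by ring
    rw [e]
    have t1 := mul_nonneg c11 (mul_nonneg (sub_nonneg.2 ha₂) (sub_nonneg.2 hb₂))
    have t2 := mul_nonneg c13 (mul_nonneg (sub_nonneg.2 ha₂) (sub_nonneg.2 hb))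
    have t3 := mul_nonneg c13 (mul_nonneg (sub_nonneg.2 ha) (sub_nonneg.2 hb₂))
    have t4 := mul_nonneg c14 (mul_nonneg (sub_nonneg.2 ha₂) hb₁₀)
    have t5 := mul_nonneg c14 (mul_nonneg ha₁₀ (sub_nonneg.2 hb₂))
    have t6 := mul_nonneg c33 (mul_nonneg (sub_nonneg.2 ha) (sub_nonneg.2 hb))
    have t7 := mul_nonneg c14 (mul_nonneg (sub_nonneg.2 ha) hb₁₀)
    have t8 := mul_nonneg c14 (mul_nonneg ha₁₀ (sub_nonneg.2 hb))
    linarith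
  · -- α = (a₁₁ - a₀₁, 0, a₀₁ - a₁₀, a₁₀), β = (b₁₁ - b₁₀, b₁₀ - b₀₁, 0, b₀₁)
    have e : p₁ * p₂ * (a₁₁ * b₁₁) + p₁ ^ 2 * (1 - p₂) * (a₁₀ * b₁₀) + (1 - p₁) * p₂ * (p₁ + (1 - p₁) * p₂) * (a₀₁ * b₀₁)
        - (p₁ * p₂ * a₁₁ + p₁ * (1 - p₂) * a₁₀ + (1 - p₁) * p₂ * a₀₁) * (p₁ * p₂ * b₁₁ + p₁ * (1 - p₂) * b₁₀ + (1 - p₁) * p₂ * b₀₁)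
        = p₁ * p₂ * (1 - p₁ * p₂) * ((a₁₁ - a₀₁) * (b₁₁ - b₁₀))
          + p₁ * p₂ * (1 - p₁) * ((a₁₁ - a₀₁) * (b₁₀ - b₀₁)) + p₁ * p₂ * (1 - p₂) * ((a₀₁ - a₁₀) * (b₁₁ - b₁₀))
          + p₁ * p₂ * ((1 - p₁) * (1 - p₂)) * ((a₁₁ - a₀₁) * b₀₁) + p₁ * p₂ * ((1 - p₁) * (1 - p₂)) * (a₁₀ * (b₁₁ - b₁₀))
          + p₁ * p₂ * ((1 - p₁) * (1 - p₂)) * ((a₀₁ - a₁₀) * b₀₁) := by ring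
    rw [e]
    have t1 := mul_nonneg c11 (mul_nonneg (sub_nonneg.2 ha₂) (sub_nonneg.2 hb₁))
    have t2 := mul_nonneg c12 (mul_nonneg (sub_nonneg.2 ha₂) (sub_nonneg.2 hb))
    have t3 := mul_nonneg c13 (mul_nonneg (sub_nonneg.2 ha) (sub_nonneg.2 hb₁))
    have t4 := mul_nonneg c14 (mul_nonneg (sub_nonneg.2 ha₂) hb₀₁)
    have t5 := mul_nonneg c14 (mul_nonneg ha₁₀ (sub_nonneg.2 hb₁))
    have t7 := mul_nonneg c14 (mul_nonneg (sub_nonneg.2 ha) hb₀₁)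
    linarith
  · -- α = (a₁₁ - a₁₀, a₁₀ - a₀₁, 0, a₀₁), β = (b₁₁ - b₀₁, 0, b₀₁ - b₁₀, b₁₀)
    have e : p₁ * p₂ * (a₁₁ * b₁₁) + p₁ ^ 2 * (1 - p₂) * (a₁₀ * b₁₀) + (1 - p₁) * p₂ * (p₁ + (1 - p₁) * p₂) * (a₀₁ * b₀₁)
        - (p₁ * p₂ * a₁₁ + p₁ * (1 - p₂) * a₁₀ + (1 - p₁) * p₂ * a₀₁) * (p₁ * p₂ * b₁₁ + p₁ * (1 - p₂) * b₁₀ + (1 - p₁) * p₂ * b₀₁)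
        = p₁ * p₂ * (1 - p₁ * p₂) * ((a₁₁ - a₁₀) * (b₁₁ - b₀₁))
          + p₁ * p₂ * (1 - p₂) * ((a₁₁ - a₁₀) * (b₀₁ - b₁₀)) + p₁ * p₂ * (1 - p₁) * ((a₁₀ - a₀₁) * (b₁₁ - b₀₁))
          + p₁ * p₂ * ((1 - p₁) * (1 - p₂)) * ((a₁₁ - a₁₀) * b₁₀) + p₁ * p₂ * ((1 - p₁) * (1 - p₂)) * (a₀₁ * (b₁₁ - b₀₁))
          + p₁ * p₂ * ((1 - p₁) * (1 - p₂)) * (a₀₁ * (b₀₁ - b₁₀)) := by ring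
    rw [e]
    have t1 := mul_nonneg c11 (mul_nonneg (sub_nonneg.2 ha₁) (sub_nonneg.2 hb₂))
    have t2 := mul_nonneg c13 (mul_nonneg (sub_nonneg.2 ha₁) (sub_nonneg.2 hb))
    have t3 := mul_nonneg c12 (mul_nonneg (sub_nonneg.2 ha) (sub_nonneg.2 hb₂))
    have t4 := mul_nonneg c14 (mul_nonneg (sub_nonneg.2 ha₁) hb₁₀)
    have t5 := mul_nonneg c14 (mul_nonneg ha₀₁ (sub_nonneg.2 hb₂))
    have t8 := mul_nonneg c14 (mul_nonneg ha₀₁ (sub_nonneg.2 hb))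
    linarith
  · -- α = (a₁₁ - a₁₀, a₁₀ - a₀₁, 0, a₀₁), β = (b₁₁ - b₁₀, b₁₀ - b₀₁, 0, b₀₁)
    have e : p₁ * p₂ * (a₁₁ * b₁₁) + p₁ ^ 2 * (1 - p₂) * (a₁₀ * b₁₀) + (1 - p₁) * p₂ * (p₁ + (1 - p₁) * p₂) * (a₀₁ * b₀₁)
        - (p₁ * p₂ * a₁₁ + p₁ * (1 - p₂) * a₁₀ + (1 - p₁) * p₂ * a₀₁) * (p₁ * p₂ * b₁₁ + p₁ * (1 - p₂) * b₁₀ + (1 - p₁) * p₂ * b₀₁)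
        = p₁ * p₂ * (1 - p₁ * p₂) * ((a₁₁ - a₁₀) * (b₁₁ - b₁₀))
          + p₁ * p₂ * (1 - p₁) * ((a₁₁ - a₁₀) * (b₁₀ - b₀₁)) + p₁ * p₂ * (1 - p₁) * ((a₁₀ - a₀₁) * (b₁₁ - b₁₀))
          + p₁ * p₂ * ((1 - p₁) * (1 - p₂)) * ((a₁₁ - a₁₀) * b₀₁) + p₁ * p₂ * ((1 - p₁) * (1 - p₂)) * (a₀₁ * (b₁₁ - b₁₀))
          + p₁ * p₂ * (1 - p₁) * ((a₁₀ - a₀₁) * (b₁₀ - b₀₁)) := by ring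
    rw [e]
    have t1 := mul_nonneg c11 (mul_nonneg (sub_nonneg.2 ha₁) (sub_nonneg.2 hb₁))
    have t2 := mul_nonneg c12 (mul_nonneg (sub_nonneg.2 ha₁) (sub_nonneg.2 hb))
    have t3 := mul_nonneg c12 (mul_nonneg (sub_nonneg.2 ha) (sub_nonneg.2 hb₁))
    have t4 := mul_nonneg c14 (mul_nonneg (sub_nonneg.2 ha₁) hb₀₁)
    have t5 := mul_nonneg c14 (mul_nonneg ha₀₁ (sub_nonneg.2 hb₁))
    have t6 := mul_nonneg c12 (mul_nonneg (sub_nonneg.2 ha) (sub_nonneg.2 hb))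
    linarith

/-- **`F(A,B;G) ≥ 0` for all increasing `A, B` when `G = {e₁ ∈ ω} ∪ {e₂ ∈ ω}` (`e₁ ≠ e₂`)** — file header; memo §22.4. [this work] -/
theorem fIneq_nonneg_of_two_coordinates (p : ι → unitInterval) {e₁ e₂ : ι} (hne : e₁ ≠ e₂) {A B : Set (Set ι)}
    (hA : IsUpperSet A) (hB : IsUpperSet B) :
    0 ≤ (1 + ex (bernoulliWeight p) (ind ({ω : Set ι | e₁ ∈ ω} ∪ {ω : Set ι | e₂ ∈ ω})))
          * ex (bernoulliWeight p) (ind (A ∩ B ∩ ({ω : Set ι | e₁ ∈ ω} ∪ {ω : Set ι | e₂ ∈ ω})))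
        - ex (bernoulliWeight p) (ind ({ω : Set ι | e₁ ∈ ω} ∪ {ω : Set ι | e₂ ∈ ω})) * ex (bernoulliWeight p) (ind (A ∩ B))
        - ex (bernoulliWeight p) (ind (A ∩ ({ω : Set ι | e₁ ∈ ω} ∪ {ω : Set ι | e₂ ∈ ω})))
          * ex (bernoulliWeight p) (ind (B ∩ ({ω : Set ι | e₁ ∈ ω} ∪ {ω : Set ι | e₂ ∈ ω}))) := by
  -- sections of G along e₁: everything / the coordinate event of e₂
  have hG1 : secAt e₁ true ({ω : Set ι | e₁ ∈ ω} ∪ {ω : Set ι | e₂ ∈ ω}) = Set.univ := by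
    rw [SahiCombDisjunct.secAt_union, SahiCombDisjunct.secAt_true_coord, Set.univ_union]
  have hG0 : secAt e₁ false ({ω : Set ι | e₁ ∈ ω} ∪ {ω : Set ι | e₂ ∈ ω}) = {ω : Set ι | e₂ ∈ ω} := by
    rw [SahiCombDisjunct.secAt_union, SahiCombDisjunct.secAt_false_coord, secAt_coord_of_ne hne, Set.empty_union]
  have hE1 : secAt e₂ true {ω : Set ι | e₂ ∈ ω} = Set.univ := SahiCombDisjunct.secAt_true_coord e₂
  have hE0 : secAt e₂ false {ω : Set ι | e₂ ∈ ω} = ∅ := SahiCombDisjunct.secAt_false_coord e₂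
  have hu : ex (bernoulliWeight p) (ind (Set.univ : Set (Set ι))) = 1 := SahiCombDisjunct.ex_ind_univ p
  have h0 : ex (bernoulliWeight p) (ind (∅ : Set (Set ι))) = 0 := SahiCombDisjunct.ex_ind_empty p
  -- the measure of G
  have hG : ex (bernoulliWeight p) (ind ({ω : Set ι | e₁ ∈ ω} ∪ {ω : Set ι | e₂ ∈ ω}))
      = (p e₁ : ℝ) + (1 - (p e₁ : ℝ)) * (p e₂ : ℝ) := by
    rw [ex_ind_eq_secAt p e₁, hG1, hG0, hu, ex_ind_eq_secAt p e₂ {ω : Set ι | e₂ ∈ ω}, hE1, hE0, hu, h0]; ring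
  -- μ(A ∩ B ∩ G)
  have hABG : ex (bernoulliWeight p) (ind (A ∩ B ∩ ({ω : Set ι | e₁ ∈ ω} ∪ {ω : Set ι | e₂ ∈ ω})))
      = (p e₁ : ℝ) * ((p e₂ : ℝ) * ex (bernoulliWeight p) (ind (secAt e₂ true (secAt e₁ true A) ∩ secAt e₂ true (secAt e₁ true B)))
          + (1 - (p e₂ : ℝ)) * ex (bernoulliWeight p) (ind (secAt e₂ false (secAt e₁ true A) ∩ secAt e₂ false (secAt e₁ true B))))
        + (1 - (p e₁ : ℝ)) * ((p e₂ : ℝ) * ex (bernoulliWeight p) (ind (secAt e₂ true (secAt e₁ false A) ∩ secAt e₂ true (secAt e₁ false B)))) := by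
    rw [ex_ind_eq_secAt p e₁ (A ∩ B ∩ _)]
    simp only [secAt_inter, hG1, hG0, Set.inter_univ]
    rw [ex_ind_eq_secAt p e₂ (secAt e₁ true A ∩ secAt e₁ true B), ex_ind_eq_secAt p e₂ (secAt e₁ false A ∩ secAt e₁ false B ∩ _)]
    simp only [secAt_inter, hE1, hE0, Set.inter_univ, Set.inter_empty, h0]
    ring
  have hAB : ex (bernoulliWeight p) (ind (A ∩ B))
      = (p e₁ : ℝ) * ((p e₂ : ℝ) * ex (bernoulliWeight p) (ind (secAt e₂ true (secAt e₁ true A) ∩ secAt e₂ true (secAt e₁ true B)))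
          + (1 - (p e₂ : ℝ)) * ex (bernoulliWeight p) (ind (secAt e₂ false (secAt e₁ true A) ∩ secAt e₂ false (secAt e₁ true B))))
        + (1 - (p e₁ : ℝ)) * ((p e₂ : ℝ) * ex (bernoulliWeight p) (ind (secAt e₂ true (secAt e₁ false A) ∩ secAt e₂ true (secAt e₁ false B)))
          + (1 - (p e₂ : ℝ)) * ex (bernoulliWeight p) (ind (secAt e₂ false (secAt e₁ false A) ∩ secAt e₂ false (secAt e₁ false B)))) := by
    rw [ex_ind_eq_secAt p e₁ (A ∩ B)]
    simp only [secAt_inter]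
    rw [ex_ind_eq_secAt p e₂ (secAt e₁ true A ∩ secAt e₁ true B), ex_ind_eq_secAt p e₂ (secAt e₁ false A ∩ secAt e₁ false B)]
    simp only [secAt_inter]
  have hAG : ex (bernoulliWeight p) (ind (A ∩ ({ω : Set ι | e₁ ∈ ω} ∪ {ω : Set ι | e₂ ∈ ω})))
      = (p e₁ : ℝ) * ((p e₂ : ℝ) * ex (bernoulliWeight p) (ind (secAt e₂ true (secAt e₁ true A)))
          + (1 - (p e₂ : ℝ)) * ex (bernoulliWeight p) (ind (secAt e₂ false (secAt e₁ true A))))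
        + (1 - (p e₁ : ℝ)) * ((p e₂ : ℝ) * ex (bernoulliWeight p) (ind (secAt e₂ true (secAt e₁ false A)))) := by
    rw [ex_ind_eq_secAt p e₁ (A ∩ _)]
    simp only [secAt_inter, hG1, hG0, Set.inter_univ]
    rw [ex_ind_eq_secAt p e₂ (secAt e₁ true A), ex_ind_eq_secAt p e₂ (secAt e₁ false A ∩ _)]
    simp only [secAt_inter, hE1, hE0, Set.inter_univ, Set.inter_empty, h0]
    ring
  have hBG : ex (bernoulliWeight p) (ind (B ∩ ({ω : Set ι | e₁ ∈ ω} ∪ {ω : Set ι | e₂ ∈ ω})))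
      = (p e₁ : ℝ) * ((p e₂ : ℝ) * ex (bernoulliWeight p) (ind (secAt e₂ true (secAt e₁ true B)))
          + (1 - (p e₂ : ℝ)) * ex (bernoulliWeight p) (ind (secAt e₂ false (secAt e₁ true B))))
        + (1 - (p e₁ : ℝ)) * ((p e₂ : ℝ) * ex (bernoulliWeight p) (ind (secAt e₂ true (secAt e₁ false B)))) := by
    rw [ex_ind_eq_secAt p e₁ (B ∩ _)]
    simp only [secAt_inter, hG1, hG0, Set.inter_univ]
    rw [ex_ind_eq_secAt p e₂ (secAt e₁ true B), ex_ind_eq_secAt p e₂ (secAt e₁ false B ∩ _)]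
    simp only [secAt_inter, hE1, hE0, Set.inter_univ, Set.inter_empty, h0]
    ring
  rw [hG, hABG, hAB, hAG, hBG]
  -- abbreviations
  set p₁ : ℝ := (p e₁ : ℝ) with hp₁def
  set p₂ : ℝ := (p e₂ : ℝ) with hp₂def
  set A11 := secAt e₂ true (secAt e₁ true A); set A10 := secAt e₂ false (secAt e₁ true A)
  set A01 := secAt e₂ true (secAt e₁ false A); set A00 := secAt e₂ false (secAt e₁ false A)
  set B11 := secAt e₂ true (secAt e₁ true B); set B10 := secAt e₂ false (secAt e₁ true B)
  set B01 := secAt e₂ true (secAt e₁ false B); set B00 := secAt e₂ false (secAt e₁ false B)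
  have hp₁ : 0 ≤ p₁ := (p e₁).2.1
  have hp₁' : p₁ ≤ 1 := (p e₁).2.2
  have hp₂ : 0 ≤ p₂ := (p e₂).2.1
  have hp₂' : p₂ ≤ 1 := (p e₂).2.2
  -- the double sections are increasing and nested
  have hA1u : IsUpperSet (secAt e₁ true A) := isUpperSet_secAt e₁ true hA
  have hA0u : IsUpperSet (secAt e₁ false A) := isUpperSet_secAt e₁ false hA
  have hB1u : IsUpperSet (secAt e₁ true B) := isUpperSet_secAt e₁ true hB
  have hB0u : IsUpperSet (secAt e₁ false B) := isUpperSet_secAt e₁ false hB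
  have sA0 : secAt e₁ false A ⊆ secAt e₁ true A := RigidityAll.secAt_false_subset_secAt_true e₁ hA
  have sB0 : secAt e₁ false B ⊆ secAt e₁ true B := RigidityAll.secAt_false_subset_secAt_true e₁ hB
  have sA10 : A10 ⊆ A11 := RigidityAll.secAt_false_subset_secAt_true e₂ hA1u
  have sA01 : A01 ⊆ A11 := RigidityAll.secAt_mono e₂ true sA0
  have sA00a : A00 ⊆ A10 := RigidityAll.secAt_mono e₂ false sA0
  have sA00b : A00 ⊆ A01 := RigidityAll.secAt_false_subset_secAt_true e₂ hA0u
  have sB10 : B10 ⊆ B11 := RigidityAll.secAt_false_subset_secAt_true e₂ hB1u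
  have sB01 : B01 ⊆ B11 := RigidityAll.secAt_mono e₂ true sB0
  have sB00a : B00 ⊆ B10 := RigidityAll.secAt_mono e₂ false sB0
  have sB00b : B00 ⊆ B01 := RigidityAll.secAt_false_subset_secAt_true e₂ hB0u
  -- numbers
  have mA10 : 0 ≤ ex (bernoulliWeight p) (ind A11) - ex (bernoulliWeight p) (ind A10) := by
    rw [ex_ind_sub_of_subset _ sA10]; exact ex_ind_nonneg' p _
  have mA01 : 0 ≤ ex (bernoulliWeight p) (ind A11) - ex (bernoulliWeight p) (ind A01) := by
    rw [ex_ind_sub_of_subset _ sA01]; exact ex_ind_nonneg' p _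
  have mB10 : 0 ≤ ex (bernoulliWeight p) (ind B11) - ex (bernoulliWeight p) (ind B10) := by
    rw [ex_ind_sub_of_subset _ sB10]; exact ex_ind_nonneg' p _
  have mB01 : 0 ≤ ex (bernoulliWeight p) (ind B11) - ex (bernoulliWeight p) (ind B01) := by
    rw [ex_ind_sub_of_subset _ sB01]; exact ex_ind_nonneg' p _
  have nA10 : 0 ≤ ex (bernoulliWeight p) (ind A10) := ex_ind_nonneg' p _
  have nA01 : 0 ≤ ex (bernoulliWeight p) (ind A01) := ex_ind_nonneg' p _
  have nB10 : 0 ≤ ex (bernoulliWeight p) (ind B10) := ex_ind_nonneg' p _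
  have nB01 : 0 ≤ ex (bernoulliWeight p) (ind B01) := ex_ind_nonneg' p _
  -- nested intersections: t⁰⁰ ≤ t¹⁰, t⁰⁰ ≤ t⁰¹
  have mT10 : 0 ≤ ex (bernoulliWeight p) (ind (A10 ∩ B10)) - ex (bernoulliWeight p) (ind (A00 ∩ B00)) := by
    rw [ex_ind_sub_of_subset _ (Set.inter_subset_inter sA00a sB00a)]; exact ex_ind_nonneg' p _
  have mT01 : 0 ≤ ex (bernoulliWeight p) (ind (A01 ∩ B01)) - ex (bernoulliWeight p) (ind (A00 ∩ B00)) := by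
    rw [ex_ind_sub_of_subset _ (Set.inter_subset_inter sA00b sB00b)]; exact ex_ind_nonneg' p _
  -- Harris on the three cells inside G
  have H11 : 0 ≤ ex (bernoulliWeight p) (ind (A11 ∩ B11)) - ex (bernoulliWeight p) (ind A11) * ex (bernoulliWeight p) (ind B11) :=
    cov_ind_nonneg p (isUpperSet_secAt e₂ true hA1u) (isUpperSet_secAt e₂ true hB1u)
  have H10 : 0 ≤ ex (bernoulliWeight p) (ind (A10 ∩ B10)) - ex (bernoulliWeight p) (ind A10) * ex (bernoulliWeight p) (ind B10) :=
    cov_ind_nonneg p (isUpperSet_secAt e₂ false hA1u) (isUpperSet_secAt e₂ false hB1u)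
  have H01 : 0 ≤ ex (bernoulliWeight p) (ind (A01 ∩ B01)) - ex (bernoulliWeight p) (ind A01) * ex (bernoulliWeight p) (ind B01) :=
    cov_ind_nonneg p (isUpperSet_secAt e₂ true hA0u) (isUpperSet_secAt e₂ true hB0u)
  -- the bilinear certificate
  have hq₁ : 0 ≤ 1 - p₁ := by linarith
  have hq₂ : 0 ≤ 1 - p₂ := by linarith
  have cop := twoCoord_copositive p₁ p₂ (ex (bernoulliWeight p) (ind A11)) (ex (bernoulliWeight p) (ind A10)) (ex (bernoulliWeight p) (ind A01))
    (ex (bernoulliWeight p) (ind B11)) (ex (bernoulliWeight p) (ind B10)) (ex (bernoulliWeight p) (ind B01))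
    hp₁ hp₁' hp₂ hp₂' nA10 nA01 (by linarith) (by linarith) nB10 nB01 (by linarith) (by linarith)
  -- weighted Harris and transport terms
  have k11 := mul_nonneg (mul_nonneg hp₁ hp₂) H11
  have k10 := mul_nonneg (mul_nonneg (mul_nonneg hp₁ hp₁) hq₂) H10
  have k01 := mul_nonneg (mul_nonneg (mul_nonneg hq₁ hp₂) (add_nonneg hp₁ (mul_nonneg hq₁ hp₂))) H01
  have w10 := mul_nonneg (mul_nonneg (mul_nonneg hq₁ hq₂) hp₁) mT10
  have w01 := mul_nonneg (mul_nonneg (mul_nonneg hq₁ hq₂) (mul_nonneg hq₁ hp₂)) mT01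
  linarith [cop, k11, k10, k01, w10, w01]

/-- **MD_3 on the D0 core when the third member is the union of two coordinates.**  Under the hypotheses of gen 20's
`sahiE_three_ge_sq_minor_of_F_nonneg`, if the (`e`-free) third member is `U_2^{e←0} = {e₁ ∈ ω} ∪ {e₂ ∈ ω}` (`e₁ ≠ e₂`) then
`(1−p_e)²E_3(U^{e←0}) + p_e²E_3(U^{e←1}) ≤ E_3(U)` unconditionally. [this work] -/
theorem sahiE_three_ge_sq_minor_of_third_two_coordinates (p : ι → unitInterval) (e : ι) {e₁ e₂ : ι} (hne : e₁ ≠ e₂)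
    (U : Fin 3 → Set (Set ι)) (hU : ∀ j, IsUpperSet (U j)) (hG : secAt e true (U 2) = secAt e false (U 2))
    (hXG : secAt e false (U 0) ⊆ secAt e false (U 2)) (hYG : secAt e false (U 1) ⊆ secAt e false (U 2))
    (hXY : ex (bernoulliWeight p) (ind (secAt e false (U 0) ∩ secAt e false (U 1)))
      = ex (bernoulliWeight p) (ind (secAt e false (U 0))) * ex (bernoulliWeight p) (ind (secAt e false (U 1))))
    (hcoord : secAt e false (U 2) = {ω : Set ι | e₁ ∈ ω} ∪ {ω : Set ι | e₂ ∈ ω}) :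
    (1 - (p e : ℝ)) ^ 2 * sahiE (bernoulliWeight p) 3 (fun j => ind (secAt e false (U j)))
      + (p e : ℝ) ^ 2 * sahiE (bernoulliWeight p) 3 (fun j => ind (secAt e true (U j)))
      ≤ sahiE (bernoulliWeight p) 3 (fun j => ind (U j)) := by
  refine sahiE_three_ge_sq_minor_of_F_nonneg p e U hU hG hXG hYG hXY ?_
  rw [hcoord]
  exact fIneq_nonneg_of_two_coordinates p hne (isUpperSet_secAt e true (hU 0)) (isUpperSet_secAt e true (hU 1))

/-! ### Appendix (gen 21, same session): the principal two-coordinate event `{e₁ ∈ ω} ∩ {e₂ ∈ ω}` — with the union case above and gen 21's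
`…FInequalityFreeCoordinates` (single coordinate; free coordinates) this puts every third event determined by at most two coordinates in the kernel. -/

/-- **`F(A,B;G) ≥ 0` for all increasing `A, B` when `G = {e₁ ∈ ω} ∩ {e₂ ∈ ω}` is a principal two-coordinate event** (`e₁ ≠ e₂`): conditioning on `(e₁,e₂)`,
`F = p₁p₂·[p₁q₂(t¹¹−t¹⁰) + q₁p₂(t¹¹−t⁰¹) + q₁q₂(t¹¹−t⁰⁰) + p₁p₂(t¹¹ − a¹¹b¹¹)]` with `t^{ab} = μ(A^{ab}∩B^{ab})` (nested sections; Harris on the top cell). [this work] -/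
theorem fIneq_nonneg_of_two_coordinates_inter (p : ι → unitInterval) {e₁ e₂ : ι} (hne : e₁ ≠ e₂) {A B : Set (Set ι)}
    (hA : IsUpperSet A) (hB : IsUpperSet B) :
    0 ≤ (1 + ex (bernoulliWeight p) (ind ({ω : Set ι | e₁ ∈ ω} ∩ {ω : Set ι | e₂ ∈ ω})))
          * ex (bernoulliWeight p) (ind (A ∩ B ∩ ({ω : Set ι | e₁ ∈ ω} ∩ {ω : Set ι | e₂ ∈ ω})))
        - ex (bernoulliWeight p) (ind ({ω : Set ι | e₁ ∈ ω} ∩ {ω : Set ι | e₂ ∈ ω})) * ex (bernoulliWeight p) (ind (A ∩ B))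
        - ex (bernoulliWeight p) (ind (A ∩ ({ω : Set ι | e₁ ∈ ω} ∩ {ω : Set ι | e₂ ∈ ω})))
          * ex (bernoulliWeight p) (ind (B ∩ ({ω : Set ι | e₁ ∈ ω} ∩ {ω : Set ι | e₂ ∈ ω}))) := by
  have hG1 : secAt e₁ true ({ω : Set ι | e₁ ∈ ω} ∩ {ω : Set ι | e₂ ∈ ω}) = {ω : Set ι | e₂ ∈ ω} := by
    rw [secAt_inter, SahiCombDisjunct.secAt_true_coord, secAt_coord_of_ne hne, Set.univ_inter]
  have hG0 : secAt e₁ false ({ω : Set ι | e₁ ∈ ω} ∩ {ω : Set ι | e₂ ∈ ω}) = ∅ := by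
    rw [secAt_inter, SahiCombDisjunct.secAt_false_coord, Set.empty_inter]
  have hE1 : secAt e₂ true {ω : Set ι | e₂ ∈ ω} = Set.univ := SahiCombDisjunct.secAt_true_coord e₂
  have hE0 : secAt e₂ false {ω : Set ι | e₂ ∈ ω} = ∅ := SahiCombDisjunct.secAt_false_coord e₂
  have hu : ex (bernoulliWeight p) (ind (Set.univ : Set (Set ι))) = 1 := SahiCombDisjunct.ex_ind_univ p
  have h0 : ex (bernoulliWeight p) (ind (∅ : Set (Set ι))) = 0 := SahiCombDisjunct.ex_ind_empty p
  have hG : ex (bernoulliWeight p) (ind ({ω : Set ι | e₁ ∈ ω} ∩ {ω : Set ι | e₂ ∈ ω})) = (p e₁ : ℝ) * (p e₂ : ℝ) := by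
    rw [ex_ind_eq_secAt p e₁, hG1, hG0, h0, ex_ind_eq_secAt p e₂ {ω : Set ι | e₂ ∈ ω}, hE1, hE0, hu, h0]; ring
  have hABG : ex (bernoulliWeight p) (ind (A ∩ B ∩ ({ω : Set ι | e₁ ∈ ω} ∩ {ω : Set ι | e₂ ∈ ω})))
      = (p e₁ : ℝ) * ((p e₂ : ℝ) * ex (bernoulliWeight p) (ind (secAt e₂ true (secAt e₁ true A) ∩ secAt e₂ true (secAt e₁ true B)))) := by
    rw [ex_ind_eq_secAt p e₁ (A ∩ B ∩ _)]
    simp only [secAt_inter, hG1, hG0, Set.inter_empty, h0]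
    rw [ex_ind_eq_secAt p e₂ (secAt e₁ true A ∩ secAt e₁ true B ∩ _)]
    simp only [secAt_inter, hE1, hE0, Set.inter_univ, Set.inter_empty, h0]
    ring
  have hAB : ex (bernoulliWeight p) (ind (A ∩ B))
      = (p e₁ : ℝ) * ((p e₂ : ℝ) * ex (bernoulliWeight p) (ind (secAt e₂ true (secAt e₁ true A) ∩ secAt e₂ true (secAt e₁ true B)))
          + (1 - (p e₂ : ℝ)) * ex (bernoulliWeight p) (ind (secAt e₂ false (secAt e₁ true A) ∩ secAt e₂ false (secAt e₁ true B))))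
        + (1 - (p e₁ : ℝ)) * ((p e₂ : ℝ) * ex (bernoulliWeight p) (ind (secAt e₂ true (secAt e₁ false A) ∩ secAt e₂ true (secAt e₁ false B)))
          + (1 - (p e₂ : ℝ)) * ex (bernoulliWeight p) (ind (secAt e₂ false (secAt e₁ false A) ∩ secAt e₂ false (secAt e₁ false B)))) := by
    rw [ex_ind_eq_secAt p e₁ (A ∩ B)]
    simp only [secAt_inter]
    rw [ex_ind_eq_secAt p e₂ (secAt e₁ true A ∩ secAt e₁ true B), ex_ind_eq_secAt p e₂ (secAt e₁ false A ∩ secAt e₁ false B)]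
    simp only [secAt_inter]
  have hAG : ex (bernoulliWeight p) (ind (A ∩ ({ω : Set ι | e₁ ∈ ω} ∩ {ω : Set ι | e₂ ∈ ω})))
      = (p e₁ : ℝ) * ((p e₂ : ℝ) * ex (bernoulliWeight p) (ind (secAt e₂ true (secAt e₁ true A)))) := by
    rw [ex_ind_eq_secAt p e₁ (A ∩ _)]
    simp only [secAt_inter, hG1, hG0, Set.inter_empty, h0]
    rw [ex_ind_eq_secAt p e₂ (secAt e₁ true A ∩ _)]
    simp only [secAt_inter, hE1, hE0, Set.inter_univ, Set.inter_empty, h0]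
    ring
  have hBG : ex (bernoulliWeight p) (ind (B ∩ ({ω : Set ι | e₁ ∈ ω} ∩ {ω : Set ι | e₂ ∈ ω})))
      = (p e₁ : ℝ) * ((p e₂ : ℝ) * ex (bernoulliWeight p) (ind (secAt e₂ true (secAt e₁ true B)))) := by
    rw [ex_ind_eq_secAt p e₁ (B ∩ _)]
    simp only [secAt_inter, hG1, hG0, Set.inter_empty, h0]
    rw [ex_ind_eq_secAt p e₂ (secAt e₁ true B ∩ _)]
    simp only [secAt_inter, hE1, hE0, Set.inter_univ, Set.inter_empty, h0]
    ring
  rw [hG, hABG, hAB, hAG, hBG]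
  have hp₁ : 0 ≤ (p e₁ : ℝ) := (p e₁).2.1
  have hp₁' : (p e₁ : ℝ) ≤ 1 := (p e₁).2.2
  have hp₂ : 0 ≤ (p e₂ : ℝ) := (p e₂).2.1
  have hp₂' : (p e₂ : ℝ) ≤ 1 := (p e₂).2.2
  have hq₁ : 0 ≤ 1 - (p e₁ : ℝ) := by linarith
  have hq₂ : 0 ≤ 1 - (p e₂ : ℝ) := by linarith
  have hA1u : IsUpperSet (secAt e₁ true A) := isUpperSet_secAt e₁ true hA
  have hB1u : IsUpperSet (secAt e₁ true B) := isUpperSet_secAt e₁ true hB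
  have sA0 : secAt e₁ false A ⊆ secAt e₁ true A := RigidityAll.secAt_false_subset_secAt_true e₁ hA
  have sB0 : secAt e₁ false B ⊆ secAt e₁ true B := RigidityAll.secAt_false_subset_secAt_true e₁ hB
  -- the three lower cells are below the top cell
  have s10 : secAt e₂ false (secAt e₁ true A) ∩ secAt e₂ false (secAt e₁ true B)
      ⊆ secAt e₂ true (secAt e₁ true A) ∩ secAt e₂ true (secAt e₁ true B) :=
    Set.inter_subset_inter (RigidityAll.secAt_false_subset_secAt_true e₂ hA1u) (RigidityAll.secAt_false_subset_secAt_true e₂ hB1u)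
  have s01 : secAt e₂ true (secAt e₁ false A) ∩ secAt e₂ true (secAt e₁ false B)
      ⊆ secAt e₂ true (secAt e₁ true A) ∩ secAt e₂ true (secAt e₁ true B) :=
    Set.inter_subset_inter (RigidityAll.secAt_mono e₂ true sA0) (RigidityAll.secAt_mono e₂ true sB0)
  have s00 : secAt e₂ false (secAt e₁ false A) ∩ secAt e₂ false (secAt e₁ false B)
      ⊆ secAt e₂ true (secAt e₁ true A) ∩ secAt e₂ true (secAt e₁ true B) :=
    subset_trans (Set.inter_subset_inter (RigidityAll.secAt_mono e₂ false sA0) (RigidityAll.secAt_mono e₂ false sB0)) s10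
  have m10 : 0 ≤ ex (bernoulliWeight p) (ind (secAt e₂ true (secAt e₁ true A) ∩ secAt e₂ true (secAt e₁ true B)))
      - ex (bernoulliWeight p) (ind (secAt e₂ false (secAt e₁ true A) ∩ secAt e₂ false (secAt e₁ true B))) := by
    rw [ex_ind_sub_of_subset _ s10]; exact ex_ind_nonneg' p _
  have m01 : 0 ≤ ex (bernoulliWeight p) (ind (secAt e₂ true (secAt e₁ true A) ∩ secAt e₂ true (secAt e₁ true B)))
      - ex (bernoulliWeight p) (ind (secAt e₂ true (secAt e₁ false A) ∩ secAt e₂ true (secAt e₁ false B))) := by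
    rw [ex_ind_sub_of_subset _ s01]; exact ex_ind_nonneg' p _
  have m00 : 0 ≤ ex (bernoulliWeight p) (ind (secAt e₂ true (secAt e₁ true A) ∩ secAt e₂ true (secAt e₁ true B)))
      - ex (bernoulliWeight p) (ind (secAt e₂ false (secAt e₁ false A) ∩ secAt e₂ false (secAt e₁ false B))) := by
    rw [ex_ind_sub_of_subset _ s00]; exact ex_ind_nonneg' p _
  have H11 : 0 ≤ ex (bernoulliWeight p) (ind (secAt e₂ true (secAt e₁ true A) ∩ secAt e₂ true (secAt e₁ true B)))
      - ex (bernoulliWeight p) (ind (secAt e₂ true (secAt e₁ true A))) * ex (bernoulliWeight p) (ind (secAt e₂ true (secAt e₁ true B))) :=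
    cov_ind_nonneg p (isUpperSet_secAt e₂ true hA1u) (isUpperSet_secAt e₂ true hB1u)
  have hpp : 0 ≤ (p e₁ : ℝ) * (p e₂ : ℝ) := mul_nonneg hp₁ hp₂
  have k10 := mul_nonneg (mul_nonneg hpp (mul_nonneg hp₁ hq₂)) m10
  have k01 := mul_nonneg (mul_nonneg hpp (mul_nonneg hq₁ hp₂)) m01
  have k00 := mul_nonneg (mul_nonneg hpp (mul_nonneg hq₁ hq₂)) m00
  have k11 := mul_nonneg (mul_nonneg hpp hpp) H11
  linarith

/-- D0-core consequence: `MD_3` at `(U,e)` is unconditional when the `e`-free third member is the principal event `{e₁ ∈ ω} ∩ {e₂ ∈ ω}`. [this work] -/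
theorem sahiE_three_ge_sq_minor_of_third_two_coordinates_inter (p : ι → unitInterval) (e : ι) {e₁ e₂ : ι} (hne : e₁ ≠ e₂)
    (U : Fin 3 → Set (Set ι)) (hU : ∀ j, IsUpperSet (U j)) (hG : secAt e true (U 2) = secAt e false (U 2))
    (hXG : secAt e false (U 0) ⊆ secAt e false (U 2)) (hYG : secAt e false (U 1) ⊆ secAt e false (U 2))
    (hXY : ex (bernoulliWeight p) (ind (secAt e false (U 0) ∩ secAt e false (U 1)))
      = ex (bernoulliWeight p) (ind (secAt e false (U 0))) * ex (bernoulliWeight p) (ind (secAt e false (U 1))))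
    (hcoord : secAt e false (U 2) = {ω : Set ι | e₁ ∈ ω} ∩ {ω : Set ι | e₂ ∈ ω}) :
    (1 - (p e : ℝ)) ^ 2 * sahiE (bernoulliWeight p) 3 (fun j => ind (secAt e false (U j)))
      + (p e : ℝ) ^ 2 * sahiE (bernoulliWeight p) 3 (fun j => ind (secAt e true (U j)))
      ≤ sahiE (bernoulliWeight p) 3 (fun j => ind (U j)) := by
  refine sahiE_three_ge_sq_minor_of_F_nonneg p e U hU hG hXG hYG hXY ?_
  rw [hcoord]
  exact fIneq_nonneg_of_two_coordinates_inter p hne (isUpperSet_secAt e true (hU 0)) (isUpperSet_secAt e true (hU 1))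

end Pointwise


end Summit.CriticalPhenomena.PercolationContinuityZ3.Theorems
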